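import Literature.MathematicalPhysics.KineticTheory.FluctuationSpace
import Literature.MathematicalPhysics.KineticTheory.HardSphereGibbsGNZSandwich
import Summits.AtomisticToContinuum.HydrodynamicLimit.Theorems.MourreKoopmanChargesStressStrongMixingGibbsMoments
import Summits.AtomisticToContinuum.HydrodynamicLimit.Theorems.MourreKoopmanChargesStressStrongMixingStressFramework
import Summits.AtomisticToContinuum.HydrodynamicLimit.Theorems.MourreKoopmanChargesStressStrongMixingTorusStressCovIdentification
import Summits.AtomisticToContinuum.HydrodynamicLimit.Theorems.MourreKoopmanChargesStressStrongMixingTorusStatics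
import Summits.AtomisticToContinuum.HydrodynamicLimit.Theorems.MourreKoopmanChargesOneBodyCompletenessCampbell
import HarnessLib

/-!
# `StressStrongMixing` · line `birth`, stub B2zero `stub_stressAutocorrelationZero`:
# the equal-time stress autocorrelation of a density-one framework is `θ²`

Support file for the crux item stmt-AtomisticToContinuum-9584 (`StressStrongMixing`, route `MourreKoopmanCharges` of
`AtomisticToContinuum/HydrodynamicLimit`), line `birth` (`Cruxes/StressStrongMixing/Lines/birth.lean`), closing the
registered stub `stub_stressAutocorrelationZero` (B2zero) VERBATIM:

  `∀ σ θ z > 0, ∀ F : HardSphereFluctuationData σ, (Gibbs σ z θ⁻¹ ∧ ∫ cellCharge 0 dμ = 1 ∧ flow =ᵐ Alexander ∧ Π ∈ 𝒱) →`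
  `⟪U_0 [Π], [Π]⟫_ℋ = θ²`,   `Π = cellObs (v ↦ v⁰v¹) = Σ_{q ∈ [0,1)³} v⁰v¹`.

Route (Spohn 1991 Part I §7.1 (7.6)–(7.7); Alexander 1976 §2.1 for the Maxwellian momenta of the DLR specification):

* `U_0 = 1` (`koopman_zero_apply`), so the left-hand side is `‖[Π]‖²_ℋ = ∫_{ℝ³} Cov_μ(Π, Π ∘ τ_x) dx`
  (`inner_fluct_fluct`, `form_def`), and `Π ∘ τ_x` is the shear stress of the shifted cell `C_x = [0,1)³ - x`;
* the stress cell observable is centred and, by the landed **second-order Campbell formula under a hard-sphere DLR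
  state** (`MourreKoopmanChargesOneBodyCompleteness.gibbsCampbellSecondMoment`: given the boundary condition and the
  number of thrown particles the velocities are i.i.d. centred Maxwellians `γ_θ = 𝒩(0, θI)` independent of the
  positions, so only the diagonal of the double sum survives), `Cov_μ(Π_C, Π_{C_x}) = (∫ (v⁰v¹)² dγ_θ) · E_μ N_{C ∩ C_x}`
  with `∫ (v⁰v¹)² dγ_θ = θ · θ = θ²` (`integral_stressGerm_sq`); the Bochner bookkeeping uses `Π_C, Π_{C_x} ∈ L²(μ)`
  (`memLp_two_cellObs_of_isHardSphereGibbs`);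
* the intensity of the translation-invariant state is `ρ · Leb` (`lintegral_count_eq_mul_volume`) with `ρ = 1`
  (`density_eq_one_of_integral_cellCharge_zero`), so `E_μ N_{C ∩ C_x} = vol(C ∩ C_x)`;
* `∫_{ℝ³} vol(C ∩ (C - x)) dx = vol(C)² = 1` (Tonelli and translation invariance of Lebesgue measure).

References: H. Spohn, *Large Scale Dynamics of Interacting Particles* (1991), Part I §7.1 (7.6)–(7.7);
R. Alexander, Comm. Math. Phys. 49 (1976), §2.1.
-/

noncomputable section

open MeasureTheory ProbabilityTheory Filter Topology
open scoped InnerProductSpace ENNReal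

namespace Summit.AtomisticToContinuum.HydrodynamicLimit.Theorems.MourreKoopmanChargesStressStrongMixing

open Literature.MathematicalPhysics.KineticTheory Literature.Analysis.FluidPDE
open Literature.Analysis.FunctionSpaces (PointConfig)
open Summit.AtomisticToContinuum.HydrodynamicLimit.Theorems.MourreKoopmanChargesOneBodyCompleteness
  (gibbsCampbellSecondMoment integral_windowStat_mul_sub_eq_zero lintegral_count_eq_mul_volume)

/-! ### Gaussian moments of the shear stress `v⁰v¹` under `γ_θ = 𝒩(0, θI)` -/

/-- The kinetic shear stress is centred under the Maxwellian: `∫ v⁰v¹ dγ_θ = 0`. [folklore] -/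
theorem integral_shearStress_gaussMeasure {θ : ℝ} (hθ : 0 < θ) :
    ∫ v, v 0 * v 1 ∂(gaussMeasure (0 : V3) θ) = 0 := by
  rw [integral_gaussMeasure (0 : V3) hθ]
  simp only [zero_add, PiLp.smul_apply, smul_eq_mul]
  exact integral_stressGerm θ

/-- The second Maxwellian moment of the kinetic shear stress: `∫ (v⁰v¹)² dγ_θ = θ²`. [folklore] -/
theorem integral_shearStress_mul_shearStress_gaussMeasure {θ : ℝ} (hθ : 0 < θ) :
    ∫ v, v 0 * v 1 * (v 0 * v 1) ∂(gaussMeasure (0 : V3) θ) = θ ^ 2 := by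
  rw [integral_gaussMeasure (0 : V3) hθ]
  simp only [zero_add, PiLp.smul_apply, smul_eq_mul]
  exact integral_stressGerm_sq hθ.le

/-! ### Counting statistics: window sums of indicators, their means at density one -/

/-- The window sum of the indicator of `B` (in the position) is the number of particles above `B` (both sides vanish
when infinitely many particles lie above `B`). [folklore] -/
theorem finsum_mem_indicator_fst_eq_ncard (B : Set V3) (ω : MarkedConfig) :
    ∑ᶠ p ∈ (ω : Set (V3 × V3)), B.indicator (1 : V3 → ℝ) p.1 =
      ((((ω : Set (V3 × V3)) ∩ B ×ˢ (Set.univ : Set V3)).ncard : ℕ) : ℝ) := by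
  have h1 : ∀ p : V3 × V3, B.indicator (1 : V3 → ℝ) p.1 = (B ×ˢ (Set.univ : Set V3)).indicator (fun _ => (1 : ℝ)) p := by
    intro p
    by_cases hp : p.1 ∈ B
    · rw [Set.indicator_of_mem hp, Set.indicator_of_mem (Set.mem_prod.2 ⟨hp, Set.mem_univ _⟩), Pi.one_apply]
    · rw [Set.indicator_of_notMem hp, Set.indicator_of_notMem fun h : p ∈ B ×ˢ (Set.univ : Set V3) => hp h.1]
  simp_rw [h1]
  rw [finsum_mem_def, Set.indicator_indicator, ← finsum_mem_def, finsum_mem_one_real]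

/-- **At density one the mean number of particles above a bounded Borel set is its volume.**  For hard-sphere
fluctuation data whose state is a DLR Gibbs state with `∫ cellCharge 0 dμ = 1` and whose flow is a.e. an equilibrium
flow (so the state is carried by hard-sphere configurations and `PointProcess.density μ = 1`), the intensity measure
of the translation-invariant state is Lebesgue measure (`lintegral_count_eq_mul_volume`), and the window sum of
`1_B` has mean `vol B`. [folklore] -/
theorem integral_finsum_indicator_eq_toReal_volume {σ θ z : ℝ} (hσ : 0 < σ) (hθ : 0 < θ) (hz : 0 < z)
    (F : HardSphereFluctuationData σ) (hG : IsHardSphereGibbs σ z θ⁻¹ (0 : V3) F.μ)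
    (hρ : ∫ ω, cellCharge 0 ω ∂F.μ = 1) {Ψ : InfiniteHardSphereFlow (Fin 3) σ} (hΨ : Ψ.IsEquilibriumFlow)
    {B : Set V3} (hB : MeasurableSet B) (hBb : Bornology.IsBounded B) :
    ∫ ω, (∑ᶠ p ∈ (ω : Set (V3 × V3)), B.indicator (1 : V3 → ℝ) p.1) ∂F.μ = (volume B).toReal := by
  haveI : IsProbabilityMeasure F.μ := hG.1
  have hfinK : ∀ K : Set V3, IsCompact K →
      ∫⁻ ω, (((ω : MarkedConfig).count (K ×ˢ (Set.univ : Set V3)) : ℕ∞) : ℝ≥0∞) ∂F.μ ≠ ⊤ := fun K hK =>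
    (lt_of_le_of_lt (HardSphereDLR.lintegral_count_le_activity_mul_volume hG hz.le (inv_pos.2 hθ)
      hK.measurableSet hK.isBounded) (ENNReal.mul_lt_top ENNReal.ofReal_lt_top hK.isBounded.measure_lt_top)).ne
  have hd : PointProcess.density F.μ = 1 :=
    density_eq_one_of_integral_cellCharge_zero hσ (isHardCore_ae_of_gibbs hθ hz hG hΨ) hρ
  have hcell : ∫⁻ ω, (((ω : MarkedConfig).count ((unitCell : Set V3) ×ˢ (Set.univ : Set V3)) : ℕ∞) : ℝ≥0∞) ∂F.μ = 1 := by
    rw [← hd, unitCell_eq_unitCube, HardSphereDLR.density_eq_lintegral_count]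
  have hS2 : ∫⁻ ω, (((ω : MarkedConfig).count (B ×ˢ (Set.univ : Set V3)) : ℕ∞) : ℝ≥0∞) ∂F.μ = volume B := by
    rw [lintegral_count_eq_mul_volume F.measurePreserving_shift hfinK hB hBb, hcell, one_mul]
  have hmeas : Measurable fun ω : MarkedConfig => (((ω.count (B ×ˢ (Set.univ : Set V3))) : ℕ∞) : ℝ≥0∞) :=
    HardSphereDLR.measurable_toENNReal_count (hB.prod MeasurableSet.univ)
  have hfin : ∀ᵐ ω ∂F.μ, (((ω : MarkedConfig).count (B ×ˢ (Set.univ : Set V3)) : ℕ∞) : ℝ≥0∞) < ⊤ :=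
    ae_lt_top hmeas (by rw [hS2]; exact hBb.measure_lt_top.ne)
  have hae : (fun ω : MarkedConfig => ∑ᶠ p ∈ (ω : Set (V3 × V3)), B.indicator (1 : V3 → ℝ) p.1) =ᵐ[F.μ]
      fun ω => ((((ω : MarkedConfig).count (B ×ˢ (Set.univ : Set V3)) : ℕ∞) : ℝ≥0∞)).toReal := by
    filter_upwards [hfin] with ω hω
    rw [ENat.toENNReal_lt_top, PointConfig.count, Set.encard_lt_top_iff] at hω
    rw [finsum_mem_indicator_fst_eq_ncard, PointConfig.coe_eq_carrier, PointConfig.count, ← hω.cast_ncard_eq,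
      ENat.toENNReal_coe, ENNReal.toReal_natCast]
  rw [integral_congr_ae hae, integral_toReal hmeas.aemeasurable hfin, hS2]

/-! ### The geometric factor `∫ vol(C ∩ (C - x)) dx = 1` -/

/-- `∫_{ℝ³} vol([0,1)³ ∩ ([0,1)³ - x)) dx = vol([0,1)³)² = 1` (Tonelli and translation invariance of Lebesgue
measure). [folklore] -/
theorem integral_toReal_volume_unitCell_inter_shift :
    ∫ x : V3, (volume ((unitCell : Set V3) ∩ (· + x) ⁻¹' unitCell)).toReal = 1 := by
  have hC : MeasurableSet (unitCell : Set V3) := measurableSet_unitCell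
  have hvC : volume (unitCell : Set V3) = 1 := Literature.MathematicalPhysics.StatisticalMechanics.volume_unitCube
  set ι : V3 → ℝ≥0∞ := (unitCell : Set V3).indicator 1 with hι
  have hιm : Measurable ι := measurable_one.indicator hC
  have hF : Measurable fun p : V3 × V3 => ι p.2 * ι (p.2 + p.1) :=
    (hιm.comp measurable_snd).mul (hιm.comp (measurable_snd.add measurable_fst))
  have hvol : ∀ x : V3, volume ((unitCell : Set V3) ∩ (· + x) ⁻¹' unitCell) = ∫⁻ q, ι q * ι (q + x) := fun x => by
    rw [← lintegral_indicator_one (hC.inter (hC.preimage (measurable_add_const x)))]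
    refine lintegral_congr fun q => ?_
    by_cases h1 : q ∈ unitCell <;> by_cases h2 : q + x ∈ unitCell <;>
      simp [hι, Set.indicator_of_mem, Set.indicator_of_notMem, h1, h2, Set.mem_preimage, Set.mem_inter_iff]
  have hfun : (fun x : V3 => volume ((unitCell : Set V3) ∩ (· + x) ⁻¹' unitCell)) = fun x => ∫⁻ q, ι q * ι (q + x) :=
    funext hvol
  have hmeas : Measurable fun x : V3 => volume ((unitCell : Set V3) ∩ (· + x) ⁻¹' unitCell) := by
    rw [hfun]
    exact hF.lintegral_prod_right'
  have hlin : ∫⁻ x : V3, volume ((unitCell : Set V3) ∩ (· + x) ⁻¹' unitCell) = 1 := by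
    rw [hfun, lintegral_lintegral_swap hF.aemeasurable]
    calc ∫⁻ q, ∫⁻ x, ι q * ι (q + x) = ∫⁻ q, ι q * ∫⁻ x : V3, ι x := by
          refine lintegral_congr fun q => ?_
          rw [lintegral_const_mul (ι q) (show Measurable fun y : V3 => ι (q + y) from hιm.comp (measurable_const_add q)),
            lintegral_add_left_eq_self ι q]
      _ = 1 := by rw [hι, lintegral_indicator_one hC, hvC, lintegral_mul_const _ hιm, lintegral_indicator_one hC, hvC, one_mul]
  have hlt : ∀ᵐ x : V3 ∂volume, volume ((unitCell : Set V3) ∩ (· + x) ⁻¹' unitCell) < ⊤ :=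
    ae_of_all _ fun x => lt_of_le_of_lt (measure_mono Set.inter_subset_left) (by rw [hvC]; exact ENNReal.one_lt_top)
  rw [integral_toReal hmeas.aemeasurable hlt, hlin, ENNReal.toReal_one]

/-! ### The equal-time truncated stress correlation of a cell and its translate -/

/-- **`Cov_μ(Π_C, Π_C ∘ τ_x) = θ² · vol(C ∩ (C - x))`** for the shear stress `Π_C = Σ_{q ∈ [0,1)³} v⁰v¹` of the unit cell
under a density-one hard-sphere DLR state at inverse temperature `θ⁻¹`: `Π_C ∘ τ_x = Π_{C - x}`, `Π_C` is centred,
the second-order Campbell formula leaves `(∫ (v⁰v¹)² dγ_θ) · E_μ N_{C ∩ (C - x)} = θ² · vol(C ∩ (C - x))`. [folklore] -/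
theorem covariance_cellObs_shearStress_shift {σ θ z : ℝ} (hσ : 0 < σ) (hθ : 0 < θ) (hz : 0 < z)
    (F : HardSphereFluctuationData σ) (hG : IsHardSphereGibbs σ z θ⁻¹ (0 : V3) F.μ)
    (hρ : ∫ ω, cellCharge 0 ω ∂F.μ = 1) {Ψ : InfiniteHardSphereFlow (Fin 3) σ} (hΨ : Ψ.IsEquilibriumFlow) (x : V3) :
    cov[cellObs (fun v : V3 => v 0 * v 1), cellObs (fun v : V3 => v 0 * v 1) ∘ spatialShift x; F.μ] =
      θ ^ 2 * (volume ((unitCell : Set V3) ∩ (· + x) ⁻¹' unitCell)).toReal := by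
  classical
  haveI : IsProbabilityMeasure F.μ := hG.1
  set g : V3 → ℝ := fun v => v 0 * v 1 with hg
  have hgc : Continuous g := by rw [hg]; fun_prop
  have hgb : ∀ v, |g v| ≤ 1 * (1 + ‖v‖) ^ 2 := abs_shearStress_le
  have hg0 : ∫ v, g v ∂(gaussMeasure (0 : V3) θ) = 0 := integral_shearStress_gaussMeasure hθ
  have hg2 : ∫ v, g v * g v ∂(gaussMeasure (0 : V3) θ) = θ ^ 2 := integral_shearStress_mul_shearStress_gaussMeasure hθ
  -- the cells `C = [0,1)³` and `C' = C - x`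
  set C : Set V3 := unitCell with hCdef
  have hC : MeasurableSet C := measurableSet_unitCell
  have hCb : Bornology.IsBounded C := isBounded_unitCell
  set C' : Set V3 := (· + x) ⁻¹' C with hC'def
  have hC' : MeasurableSet C' := hC.preimage (measurable_add_const x)
  have hC'b : Bornology.IsBounded C' := (isometry_add_right x).antilipschitz.isBounded_preimage hCb
  -- the two observables as window sums
  have hX : ∀ ω : MarkedConfig, cellObs g ω =
      ∑ᶠ p ∈ (ω : Set (V3 × V3)), C.indicator (1 : V3 → ℝ) p.1 * g p.2 := fun ω => by
    simp only [cellObs, linStat]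
    refine finsum_mem_congr rfl fun p _ => ?_
    simp only [Set.indicator_apply, Pi.one_apply]
    split_ifs <;> simp
  have hY : ∀ ω : MarkedConfig, (cellObs g ∘ spatialShift x) ω =
      ∑ᶠ p ∈ (ω : Set (V3 × V3)), C'.indicator (1 : V3 → ℝ) p.1 * g p.2 := fun ω => by
    simp only [Function.comp_apply, spatialShift_apply, cellObs, linStat, PointConfig.coe_eq_carrier,
      PointConfig.carrier_translate]
    rw [finsum_mem_image (add_left_injective _).injOn]
    refine finsum_mem_congr rfl fun p _ => ?_
    simp only [hC'def, Prod.fst_add, Prod.snd_add, add_zero, Set.indicator_apply, Set.mem_preimage, Pi.one_apply]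
    split_ifs <;> simp
  -- the stress cell observable is centred
  have hmean : F.μ[cellObs g] = 0 := by
    have key := integral_windowStat_mul_sub_eq_zero hz hθ hG hgc continuous_const hgb (e := fun _ => (0 : ℝ))
      (Ce := 1) (ke := 0) (fun v => by simp) hg0 (by simp) hC hC hCb hCb (-1)
    simp only [mul_zero, finsum_mem_zero, zero_sub, neg_neg, mul_one] at key
    simp_rw [hX]
    exact key
  -- square integrability and the Bochner bookkeeping
  have hXL2 : MemLp (cellObs g) 2 F.μ := memLp_two_cellObs_of_isHardSphereGibbs hz.le hθ hG hgc.measurable hgb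
  have hYL2 : MemLp (cellObs g ∘ spatialShift x) 2 F.μ := hXL2.comp_measurePreserving (F.measurePreserving_shift x)
  set b : ℝ := F.μ[cellObs g ∘ spatialShift x] with hb
  have hprod : Integrable (fun ω => cellObs g ω * ((cellObs g ∘ spatialShift x) ω - b)) F.μ :=
    hXL2.integrable_mul (hYL2.sub (memLp_const b))
  have hprod' : Integrable (fun ω : MarkedConfig => (∑ᶠ p ∈ (ω : Set (V3 × V3)), C.indicator (1 : V3 → ℝ) p.1 * g p.2) *
      ((∑ᶠ p ∈ (ω : Set (V3 × V3)), C'.indicator (1 : V3 → ℝ) p.1 * g p.2) - b)) F.μ := by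
    refine hprod.congr (ae_of_all _ fun ω => ?_)
    simp only [hX ω, hY ω]
  have hNL2 : MemLp (linStat fun p : V3 × V3 => (C ∩ C').indicator (1 : V3 → ℝ) p.1) 2 F.μ :=
    memLp_two_linStat_of_isHardSphereGibbs hz.le hθ hG (hC.inter hC') (hCb.subset Set.inter_subset_left)
      ((measurable_one.indicator (hC.inter hC')).comp measurable_fst) (C := 1) (n := 0)
      (fun p => by
        rw [pow_zero, mul_one]
        simp only [Set.indicator_apply, Pi.one_apply]
        split_ifs <;> simp)
      (fun p hp => Set.indicator_of_notMem hp _)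
  have hNi : Integrable (fun ω : MarkedConfig =>
      ∑ᶠ p ∈ (ω : Set (V3 × V3)), (C ∩ C').indicator (1 : V3 → ℝ) p.1) F.μ :=
    hNL2.integrable one_le_two
  -- the second-order Campbell formula
  have hcamp := gibbsCampbellSecondMoment σ z θ hz hθ F.μ hG g g hgc hgc ⟨1, 2, hgb⟩ ⟨1, 2, hgb⟩ hg0 C C' hC hC'
    hCb hC'b b
  rw [hg2] at hcamp
  have hA : ∫ ω, (∑ᶠ p ∈ (ω : Set (V3 × V3)), C.indicator (1 : V3 → ℝ) p.1 * g p.2) *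
      ((∑ᶠ p ∈ (ω : Set (V3 × V3)), C'.indicator (1 : V3 → ℝ) p.1 * g p.2) - b) ∂F.μ =
      θ ^ 2 * ∫ ω, (∑ᶠ p ∈ (ω : Set (V3 × V3)), (C ∩ C').indicator (1 : V3 → ℝ) p.1) ∂F.μ := by
    have h1 := integral_sub hprod' (hNi.const_mul (θ ^ 2))
    rw [hcamp, integral_const_mul] at h1
    linarith
  calc cov[cellObs g, cellObs g ∘ spatialShift x; F.μ]
      = ∫ ω, cellObs g ω * ((cellObs g ∘ spatialShift x) ω - b) ∂F.μ := by
        rw [covariance, hmean]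
        simp only [sub_zero, hb]
    _ = ∫ ω, (∑ᶠ p ∈ (ω : Set (V3 × V3)), C.indicator (1 : V3 → ℝ) p.1 * g p.2) *
          ((∑ᶠ p ∈ (ω : Set (V3 × V3)), C'.indicator (1 : V3 → ℝ) p.1 * g p.2) - b) ∂F.μ :=
        integral_congr_ae (ae_of_all _ fun ω => by simp only [hX ω, hY ω])
    _ = θ ^ 2 * ∫ ω, (∑ᶠ p ∈ (ω : Set (V3 × V3)), (C ∩ C').indicator (1 : V3 → ℝ) p.1) ∂F.μ := hA
    _ = θ ^ 2 * (volume (C ∩ C')).toReal := by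
        rw [integral_finsum_indicator_eq_toReal_volume hσ hθ hz F hG hρ hΨ (hC.inter hC')
          (hCb.subset Set.inter_subset_left)]

/-! ### The registered stub -/

/-- **Registered stub `stub_stressAutocorrelationZero`** (B2zero of line `birth` of `StressStrongMixing`): on every
density-one framework — hard-sphere fluctuation data `F` at reduced diameter `σ` whose state is a DLR Gibbs state of the
hard-sphere gas at activity `z`, inverse temperature `θ⁻¹`, zero drift, of density one, whose flow is a.e. an
equilibrium Alexander flow and for which the kinetic shear stress of the unit cell is a local observable — the
equal-time stress autocorrelation is `c_F(0) = ⟪U_0 ξ_Π, ξ_Π⟫_ℋ = ‖ξ_Π‖²_ℋ = θ²`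
(`‖[Π]‖² = ∫ Cov_μ(Π_C, Π_{C-x}) dx = θ² ∫ vol(C ∩ (C - x)) dx = θ²`). [folklore] -/
theorem stub_stressAutocorrelationZero :
    ∀ (σ θ z : ℝ), 0 < σ → 0 < θ → 0 < z → ∀ F : HardSphereFluctuationData σ,
      (IsHardSphereGibbs σ z θ⁻¹ (0 : V3) F.μ ∧
        (∫ ω, cellCharge 0 ω ∂F.μ = 1) ∧
        (∃ Φ : InfiniteHardSphereFlow (Fin 3) σ, Φ.IsEquilibriumFlow ∧ ∀ t : ℝ, F.flow t =ᵐ[F.μ] Φ.flow t) ∧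
        cellObs (fun v : V3 => v 0 * v 1) ∈ F.localObs) →
      ⟪F.koopman 0 (F.fluct (cellObs fun v : V3 => v 0 * v 1)),
        F.fluct (cellObs fun v : V3 => v 0 * v 1)⟫_ℝ = θ ^ 2 := by
  intro σ θ z hσ hθ hz F hF
  obtain ⟨hG, hρ, ⟨Ψ, hΨ, -⟩, hPi⟩ := hF
  rw [F.koopman_zero_apply, FluctuationStructure.inner_fluct_fluct hPi hPi, FluctuationStructure.form_def]
  have hcov : ∀ x : V3,
      cov[cellObs (fun v : V3 => v 0 * v 1), cellObs (fun v : V3 => v 0 * v 1) ∘ spatialShift x; F.μ] =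
        θ ^ 2 * (volume ((unitCell : Set V3) ∩ (· + x) ⁻¹' unitCell)).toReal := fun x =>
    covariance_cellObs_shearStress_shift hσ hθ hz F hG hρ hΨ x
  calc ∫ x, cov[cellObs (fun v : V3 => v 0 * v 1), cellObs (fun v : V3 => v 0 * v 1) ∘ spatialShift x; F.μ]
      = ∫ x : V3, θ ^ 2 * (volume ((unitCell : Set V3) ∩ (· + x) ⁻¹' unitCell)).toReal :=
        integral_congr_ae (ae_of_all _ hcov)
    _ = θ ^ 2 := by rw [integral_const_mul, integral_toReal_volume_unitCell_inter_shift, mul_one]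

end Summit.AtomisticToContinuum.HydrodynamicLimit.Theorems.MourreKoopmanChargesStressStrongMixing

end
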